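import Literature.NumberTheory.EllipticCurves.ModularSymbols
import HarnessLib

/-!
# Shimura's theorem on the periods of Galois-CONJUGATE newforms: the normalised modular symbols
# `{∞, r}⁺_f / Ω⁺_f`, `{∞, r}⁻_f / (iΩ⁻_f)` are `Aut(ℂ)`-equivariant (Shimura 1977, Thm. 1) — named facts

Topic `NumberTheory/EllipticCurves`; namespace `Literature.NumberTheory.EllipticCurves.ModularForms`; sibling of
`NewformPeriodsCoeffField.lean`, which PROVES the single-form half of the same theorem
(`IsNewform0.exists_plusSymbol_eq_mul`: `plusSymbol f r ∈ K_f · Ω⁺_f`; `IsNewform0.exists_minusSymbol_eq_mul`).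
TWO named facts (D-0014, `def X : Prop`, cited, statement only), the `σ`-EQUIVARIANCE half:

> G. Shimura, *On the periods of modular forms*, Math. Ann. **229** (1977) 211–221, **Theorem 1** (as used in
> [PollackWeston2011MT] §2.2, [GreenbergVatsal2000] §3, [Vatsal1999] §1): for a primitive form `f = ∑ a_n qⁿ` of
> weight `k` with coefficient field `K_f` there are complex numbers `u⁺(f)`, `u⁻(f)` ("periods") such that for every
> Dirichlet character `χ` and every integer `0 < m < k` the normalised special value
> `A(m, f, χ) := L(m, f, χ) / ((2πi)^m · τ(χ) · u^±(f))` (`±` the sign of `χ(−1)(−1)^m`, `τ(χ)` the Gauss sum) is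
> ALGEBRAIC, lies in `K_f K_χ`, and for every automorphism `σ` of `ℂ`: `A(m, f, χ)^σ = A(m, f^σ, χ^σ)`, where
> `f^σ = ∑ σ(a_n) qⁿ` is the conjugate primitive form and the periods `u^±(f^σ)` are chosen coherently.

## Rendering (read before reviewing)

* Weight `k = 2`, `m = 1`, trivial Nebentypus: `f ∈ S₂(Γ₀(N))` a normalised newform (`IsNewform0`, the tree's
  `Newforms.lean`); its coefficient field `coeffField f = ℚ(a_n(f) : n)` is a (totally) real number field
  (`IsNewform0.coeffField_le_realSubfield`), so an automorphism `σ` of `ℂ` acts on `f` through the field embedding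
  `σ : coeffField f →+* ℂ`; the conjugate form `f^σ` is rendered as a SECOND newform `f' ∈ S₂(Γ₀(N))` (same level)
  with `cuspCoeff f' n = σ(cuspCoeff f n)` for all `n` (that `∑ σ(a_n)qⁿ` is again a newform of level `N` is part of
  the printed statement — Shimura 1971 Thm. 3.48 / [Shimura1977] §1 — and is NOT asserted here: the fact only speaks
  about pairs `(f, f')` that ARE conjugate newforms).
* MODULAR-SYMBOL FORM. For `m = 1`, `k = 2` and EVEN `χ` (sign `+`) the values `L(1, f, χ)`, `χ` ranging over the
  characters of all conductors, and the plus symbols `plusSymbol f r = ({∞,r}_f + {∞,−r}_f)/2`, `r ∈ ℚ`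
  (`ModularSymbols.lean`), determine each other `K_f K_χ`-rationally and `σ`-equivariantly by Birch's formula
  `τ(χ̄) L(f, χ, 1) = ∑_{a mod c} χ̄(a) {∞, a/c}_f` (tree theorem `twisted_LValue_eq_holds`) and finite Fourier
  inversion on `(ℤ/c)ˣ` ([MazurTateTeitelbaum1986Invent] §I.8; [Manin1972] for `K_f = ℚ`); Theorem 1 for the sign `+`
  is therefore rendered EXACTLY as the tree renders its single-form half (`NewformPeriodsCoeffField`): there are
  real periods `Ω ≠ 0` of `f` and `Ω' ≠ 0` of `f'` and `K_f`-valued normalised symbols `q(r) = {∞,r}⁺_f/Ω` with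
  `{∞,r}⁺_{f'} = σ(q(r)) · Ω'` for every `r ∈ ℚ` (`shimura1977_plusSymbol_galoisEquivariant`); the sign `−`
  (odd `χ`) likewise with `minusSymbol` and the purely imaginary periods `iΩ⁻` (`shimura1977_minusSymbol_galoisEquivariant`).
* The periods are real / purely imaginary because `K_f, K_{f'} ⊂ ℝ` and `a_n ∈ ℝ` (`plusSymbol_eq_re_holds`); Shimura's
  `u^±` are only determined up to `(K_f)ˣ`, which the `∃ Ω Ω'` absorbs.
* PROVABLE IN THE TREE (not done here; recorded for a prover): `σ`-semilinear transport on the `K_f`-structure of the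
  period homology used in `NewformPeriodsCoeffField` — with `H_K = ⊕ K φ_i ⊇ Λ`, `U_f = ∑_{p ∤ N} (T_p^∨ − a_p) H_K`,
  the evaluation `H_K/U_f → K·Λ_f = KΩ⁺ ⊕ KiΩ⁻` is an ISOMORPHISM (the tree proves `dim ≤ 2` and that the image has
  dimension `2`), `id ⊗ σ : H_K → H_{σK}` carries `U_f` onto `U_{f'}` and fixes the `ℚ`-rational Manin–Drinfeld
  symbols `{∞,r} ± {∞,−r}`; reading the class of `{∞,r}⁺` against a fixed rational generator of the `+`-line gives
  `q(r) ∈ K_f` for `f` and `σ(q(r))` for `f'`.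
* Consumer: crux L of `Summits/BirchSwinnertonDyer` (route `SignedLowerHalves`, stub S4″ of line `rtt_w3`): the
  transport hypothesis `hsym` of `SmallImageRttReciprocity.mul_eval₂_mazurTateElementK_eq_gaussSum_mul` for the
  CM theta partner `g^{e∘ι} = θ_ψ` read through a `p`-adic embedding `ι` and `e : ℚ̄_p ≃ ℂ`.
  -- TODO(general form): weights `k > 2` (all critical `m`), Nebentypus `ψ ≠ 1` on `Γ₁(N)`, clause (iii) of Theorem 1
  -- (`i^{1−k} π ⟨f, f⟩ / (u⁺(f) u⁻(f)) ∈ K_f`, equivariantly), and the `L`-value form for imprimitive `χ`.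
* `lean search 'galoisEquivariant|conj.*plusSymbol|plusSymbol.*σ'` (2026-08-31): no equivariance statement in the tree;
  the single-form statements are the theorems of `NewformPeriodsCoeffField.lean` cited above.

## References

* G. Shimura, *On the periods of modular forms*, Math. Ann. 229 (1977) 211–221, Thm. 1. [Shimura1977]
* G. Shimura, *The special values of the zeta functions associated with cusp forms*, Comm. Pure Appl. Math. 29 (1976)
  783–804, Thm. 1 (the `L`-value algebraicity). [Shimura1976]
* B. Mazur, J. Tate, J. Teitelbaum, Invent. Math. 84 (1986), §I.8 (Birch's formula (8.6)). [MazurTateTeitelbaum1986Invent]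
* R. Pollack, T. Weston, Duke Math. J. 156 (2011), §2.2 ("By a theorem of Shimura … `ξ^±_f` takes values in
  `V_{k−2}(K_f) Ω^±_f`"). [PollackWeston2011MT]
* Ju. I. Manin, Izv. Akad. Nauk SSSR 36 (1972), Cor. 3.6 (the case `K_f = ℚ`). [Manin1972]
-/

noncomputable section

open scoped MatrixGroups ModularForm

open CongruenceSubgroup

namespace Literature.NumberTheory.EllipticCurves.ModularForms

/-- **Shimura 1977, Theorem 1 — `Aut(ℂ)`-equivariance of the normalised PLUS symbols of conjugate newforms**
(weight `2`, trivial Nebentypus, modular-symbol form; see the module docstring for the printed `L`-value form and the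
rendering): for normalised newforms `f, f' ∈ S₂(Γ₀(N))` and a field embedding `σ : K_f → ℂ` with
`a_n(f') = σ(a_n(f))` for all `n` (i.e. `f' = f^σ`), there are REAL periods `Ω ≠ 0` (of `f`) and `Ω' ≠ 0` (of `f'`) and
`K_f`-valued normalised symbols `q : ℚ → K_f` with `{∞,r}⁺_f = q(r)·Ω` and `{∞,r}⁺_{f'} = σ(q(r))·Ω'` for every
`r ∈ ℚ` — "`(L(1,f,χ)/(2πi τ(χ) u⁺(f)))^σ = L(1,f^σ,χ^σ)/(2πi τ(χ^σ) u⁺(f^σ))` for even `χ`". The single-form statement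
(`q(r) ∈ K_f`) is the tree THEOREM `IsNewform0.exists_plusSymbol_eq_mul`. [cite: Shimura1977, Thm. 1] -/
def shimura1977_plusSymbol_galoisEquivariant : Prop :=
  ∀ (N : ℕ) [NeZero N] (f f' : CuspForm (Gamma0 N) 2), IsNewform0 f → IsNewform0 f' →
    ∀ σ : coeffField f →+* ℂ, (∀ n : ℕ, cuspCoeff f' n = σ ⟨cuspCoeff f n, coeff_mem_coeffField f n⟩) →
      ∃ Ω Ω' : ℝ, Ω ≠ 0 ∧ Ω' ≠ 0 ∧ ∃ q : ℚ → coeffField f,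
        ∀ r : ℚ, plusSymbol f r = (q r : ℂ) * Ω ∧ plusSymbol f' r = σ (q r) * Ω'

/-- **Shimura 1977, Theorem 1 — `Aut(ℂ)`-equivariance of the normalised MINUS symbols of conjugate newforms**
(weight `2`, trivial Nebentypus, modular-symbol form): for normalised newforms `f, f' ∈ S₂(Γ₀(N))` and
`σ : K_f → ℂ` with `a_n(f') = σ(a_n(f))` for all `n`, there are real `Ω ≠ 0`, `Ω' ≠ 0` and `q : ℚ → K_f` with
`{∞,r}⁻_f = q(r)·iΩ` and `{∞,r}⁻_{f'} = σ(q(r))·iΩ'` for every `r ∈ ℚ` — "`(L(1,f,χ)/(2πi τ(χ) u⁻(f)))^σ =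
L(1,f^σ,χ^σ)/(2πi τ(χ^σ) u⁻(f^σ))` for odd `χ`". The single-form statement is the tree THEOREM
`IsNewform0.exists_minusSymbol_eq_mul`. [cite: Shimura1977, Thm. 1] -/
def shimura1977_minusSymbol_galoisEquivariant : Prop :=
  ∀ (N : ℕ) [NeZero N] (f f' : CuspForm (Gamma0 N) 2), IsNewform0 f → IsNewform0 f' →
    ∀ σ : coeffField f →+* ℂ, (∀ n : ℕ, cuspCoeff f' n = σ ⟨cuspCoeff f n, coeff_mem_coeffField f n⟩) →
      ∃ Ω Ω' : ℝ, Ω ≠ 0 ∧ Ω' ≠ 0 ∧ ∃ q : ℚ → coeffField f,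
        ∀ r : ℚ, minusSymbol f r = (q r : ℂ) * Ω * Complex.I ∧ minusSymbol f' r = σ (q r) * Ω' * Complex.I

end Literature.NumberTheory.EllipticCurves.ModularForms

end
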